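/-
Origin: expansion seat `planner-pub-hodgecm-pv05-g6-0`, handover #9 2026-08-18T12:27:50Z (`HOME/pub-hodgecm-pv05-g6/lean/Pv05g6/FockUnitaryCommutant.lean`, md5 0b3db878, 339 lines);
landed by the gen-8 packager in gate run 29 as `HodgeCM/PerL34/FockUnitaryCommutant.lean` (import ^import Pv05g6\.FockKFiniteDense[ \t]*$→import HodgeCM.PerL34.FockKFiniteDense ×1).
-/
import Mathlib.Analysis.Complex.Polynomial.Basic
import Mathlib.LinearAlgebra.Eigenspace.Triangularizable
import Summits.HodgeConjecture.HodgeCM.PerL34.FockKFiniteDense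

set_option autoImplicit false

/-!
# The commutant of `U(σ)` on the genuine `L²` Fock space: bounded intertwiners are degree multipliers

Node-style kernel file #9 of seat `pub-hodgecm-pv05-g6` (Fock–Hermite genuine-`L²` lane).  Additive: it imports only
`FockKFiniteDense` (#8) plus two Mathlib modules (`IsAlgClosed ℂ`, `Module.End.exists_eigenvalue`); no `Literature`,
no `HarnessLib`, no cited fact, no hypothesis beyond the ones displayed.

Here `FockL2 σ` is the GENUINE Fock space (a closed subspace of `L²(ℂ^σ, π^{-σ} e^{-π|z|²} dz)`, tree file
`FockSpaceL2`), `fockRep : U(σ) →* (FockL2 σ ≃ₗᵢ[ℂ] FockL2 σ)` is the honest unitary action `(ν₀(U)F)(z) = F(U⁻¹z)`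
(#1), `circleRep` its restriction to the centre `U(1)` (#2) and `𝓟ₖ = degSpan {k}` the homogeneous pieces.

## What is proved (namespace `HodgeCM.PerL34.Fock.Hermite`)

* `map_mem_degSpan_singleton_of_comm_centre`: a LINEAR operator commuting with the centre `U(1)` maps each `𝓟ₖ`
  into itself (the `𝓟ₖ` are the `U(1)`-isotypic components, #3 `isotypic_iff`); `centreCommutant_iff`: for a
  bounded operator this is an equivalence.
* `exists_scalar_on_degSpan_singleton` (**Schur**): a linear operator commuting with `ν₀(U(σ))` acts on each `𝓟ₖ` by
  a scalar — an eigen-submodule of the finite-dimensional invariant piece `𝓟ₖ` is `U(σ)`-stable and non-zero,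
  hence all of `𝓟ₖ` by irreducibility (#6 `degSpan_singleton_irreducible`).
* **`unitaryCommutant_iff (T : FockL2 σ →L[ℂ] FockL2 σ) :
    (∀ U x, T (fockRep U x) = fockRep U (T x)) ↔ ∃ c : ℕ → ℂ, ∀ k, ∀ x ∈ 𝓟ₖ, T x = c k • x`** —
  the commutant of `ν₀(U(σ))` in `B(FockL2 σ)` is exactly the algebra of bounded DEGREE MULTIPLIERS
  (`T ζ_β = c_{|β|} ζ_β`, `degreeMultiplier_fockBasis`, with the norm-convergent expansion
  `degreeMultiplier_hasSum : T v = Σ_β c_{|β|} ⟨ζ_β, v⟩ ζ_β`), i.e. the bounded functions of the number operator;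
  in particular it is COMMUTATIVE (`unitaryCommutant_comm`): the decomposition `𝓕_σ = ⊕̂ₖ 𝓟ₖ` is multiplicity-free,
  and `ν₀(U(σ))' ⊆ ν₀(U(1))''` (`unitaryCommutant_comm_of_centreCommutant`) — the `(U(σ), U(1))` instance of Howe's
  duality on the genuine Fock space, at the level of bounded operators.  (The tree file `FockCommutant` proves the analogous module-level statement for the
  POLYNOMIAL model of the pair `(U(1), U(2,1))`; the present file concerns a different pair and the analytic
  `L²` model, and shares no declaration with it.)
* `degSpan_intertwiner_eq_zero`: for `k ≠ l` every linear `𝓟ₖ → 𝓟ₗ` intertwining the restricted `U(σ)`-actions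
  is zero — the representations on the `𝓟ₖ` are pairwise INEQUIVALENT ([Fo89] p. 182 line 39, kernel, all `σ`).
* `schrodingerCommutant_iff`: the same theorem in the Schrödinger model `L²(ℝ^σ)` — a bounded operator commutes
  with every `schrodingerU U = B⁻¹ν₀(U)B` iff it is a scalar on each Hermite piece `hermDegSpan k = span
  {h_α : |α| = k}` (#6) — transported through the Bargmann unitary `B` (tree file `FockBargmann`).

## Published statements (quoted verbatim from the materialised text; line numbers of the page files `pNNNN.txt`)

[Fo89] G. B. Folland, *Harmonic Analysis in Phase Space*, Annals of Mathematics Studies 122, Princeton UP 1989,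
p. 182, line 39: "Moreover, each  $\mathcal{P}_k$  is irreducible under the action of U(n)." … "The
representations of U(n) on the spaces  $\mathcal{P}_k$  are all inequivalent: if n > 1 this is obvious since the
spaces  $\mathcal{P}_k$  all have different dimensions, while if n = 1 it is obvious by inspection. (U(1) acts on
$\mathcal{P}_k$  in dimension 1 by the representation  $e^{i\theta} \to e^{-ik\theta}$ .)"  The first sentence is
#6 (kernel); of the second, exactly the consequence needed here — no non-zero intertwiner of `𝓕_σ` mixes two
different degrees — is kernel-proved in §1 from the CENTRE alone (different `U(1)`-characters), which is Folland's
parenthetical argument run for every n.  Nothing on this page is used as a hypothesis.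
-/

noncomputable section

open MeasureTheory Complex MvPolynomial Matrix Filter Topology
open scoped Real ComplexConjugate InnerProductSpace

namespace HodgeCM.PerL34.Fock.Hermite

variable {σ : Type*} [Fintype σ] [DecidableEq σ]

/-! ## 1. Operators commuting with the centre preserve every `𝓟ₖ` -/

/-- A linear operator commuting with the centre `U(1)` maps each `U(1)`-isotypic piece `𝓟ₖ` into itself. -/
theorem map_mem_degSpan_singleton_of_comm_centre (T : FockL2 σ →ₗ[ℂ] FockL2 σ)
    (hT : ∀ c : Circle, ∀ x : FockL2 σ, T (circleRep c x) = circleRep c (T x)) {k : ℕ} {x : FockL2 σ}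
    (hx : x ∈ degSpan ({k} : Set ℕ)) : T x ∈ degSpan ({k} : Set ℕ) := by
  rw [← isotypic_iff] at hx ⊢
  intro c
  rw [← hT, hx c, map_smul]

/-- A linear operator commuting with `ν₀(U(σ))` maps each `𝓟ₖ` into itself. -/
theorem map_mem_degSpan_singleton_of_comm (T : FockL2 σ →ₗ[ℂ] FockL2 σ)
    (hT : ∀ U : Matrix.unitaryGroup σ ℂ, ∀ x : FockL2 σ, T (fockRep U x) = fockRep U (T x)) {k : ℕ}
    {x : FockL2 σ} (hx : x ∈ degSpan ({k} : Set ℕ)) : T x ∈ degSpan ({k} : Set ℕ) :=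
  map_mem_degSpan_singleton_of_comm_centre T (fun c x => hT (scalarU c) x) hx

omit [DecidableEq σ] in
/-- (Ported verbatim from the HodgeCMPerL package; no docstring in the source.) -/
theorem fockBasis_mem_degSpan_singleton (β : σ →₀ ℕ) :
    (fockBasis β : FockL2 σ) ∈ degSpan ({mdeg β} : Set ℕ) :=
  Submodule.subset_span ⟨β, rfl, rfl⟩

omit [DecidableEq σ] in
/-- Two bounded operators on `𝓕_σ` that agree on the orthonormal basis `ζ_β` are equal. -/
theorem clm_eq_of_fockBasis {E : Type*} [NormedAddCommGroup E] [NormedSpace ℂ E] {f g : FockL2 σ →L[ℂ] E}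
    (h : ∀ β : σ →₀ ℕ, f (fockBasis β) = g (fockBasis β)) : f = g := by
  refine ContinuousLinearMap.ext_on (s := Set.range (⇑(fockBasis (σ := σ)))) ?_ ?_
  · rw [Submodule.dense_iff_topologicalClosure_eq_top]
    exact (fockBasis (σ := σ)).dense_span
  · rintro _ ⟨β, rfl⟩
    exact h β

/-- For a BOUNDED operator, commuting with the centre is equivalent to preserving every `𝓟ₖ`
(the commutant of `ν₀(U(1))` = the block-diagonal operators). -/
theorem centreCommutant_iff (T : FockL2 σ →L[ℂ] FockL2 σ) :
    (∀ c : Circle, ∀ x : FockL2 σ, T (circleRep c x) = circleRep c (T x)) ↔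
      ∀ k : ℕ, ∀ x ∈ degSpan ({k} : Set ℕ), T x ∈ degSpan ({k} : Set ℕ) := by
  constructor
  · intro hT k x hx
    exact map_mem_degSpan_singleton_of_comm_centre (T : FockL2 σ →ₗ[ℂ] FockL2 σ) (fun c x => hT c x) hx
  · intro hT c x
    have key : T.comp (circleRep (σ := σ) c).toContinuousLinearEquiv.toContinuousLinearMap =
        (circleRep (σ := σ) c).toContinuousLinearEquiv.toContinuousLinearMap.comp T := by
      refine clm_eq_of_fockBasis fun β => ?_
      simp only [ContinuousLinearMap.comp_apply, ContinuousLinearEquiv.coe_coe,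
        LinearIsometryEquiv.coe_toContinuousLinearEquiv]
      rw [circleRep_of_mem_degSpan_singleton (fockBasis_mem_degSpan_singleton β) c,
        circleRep_of_mem_degSpan_singleton (hT _ _ (fockBasis_mem_degSpan_singleton β)) c, map_smul]
    have := DFunLike.congr_fun key x
    simpa only [ContinuousLinearMap.comp_apply, ContinuousLinearEquiv.coe_coe,
      LinearIsometryEquiv.coe_toContinuousLinearEquiv] using this

/-! ## 2. Schur's lemma on the irreducible pieces `𝓟ₖ` -/

/-- **Schur.** A linear operator commuting with `ν₀(U(σ))` acts on each `𝓟ₖ` by a scalar. -/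
theorem exists_scalar_on_degSpan_singleton (T : FockL2 σ →ₗ[ℂ] FockL2 σ)
    (hT : ∀ U : Matrix.unitaryGroup σ ℂ, ∀ x : FockL2 σ, T (fockRep U x) = fockRep U (T x)) (k : ℕ) :
    ∃ c : ℂ, ∀ x ∈ degSpan ({k} : Set ℕ), T x = c • x := by
  have hTP : ∀ x ∈ degSpan (σ := σ) ({k} : Set ℕ), T x ∈ degSpan (σ := σ) ({k} : Set ℕ) :=
    fun x hx => map_mem_degSpan_singleton_of_comm T hT hx
  by_cases hP : degSpan (σ := σ) ({k} : Set ℕ) = ⊥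
  · refine ⟨0, fun x hx => ?_⟩
    rw [hP, Submodule.mem_bot] at hx
    rw [hx, map_zero, smul_zero]
  haveI : Nontrivial (degSpan (σ := σ) ({k} : Set ℕ)) := Submodule.nontrivial_iff_ne_bot.mpr hP
  obtain ⟨c, hc⟩ := Module.End.exists_eigenvalue (T.restrict hTP)
  obtain ⟨v, hv⟩ := hc.exists_hasEigenvector
  refine ⟨c, ?_⟩
  -- the eigen-submodule of the restriction, viewed inside `𝓕_σ`
  set W : Submodule ℂ (FockL2 σ) :=
    (Module.End.eigenspace (T.restrict hTP) c).map (degSpan (σ := σ) ({k} : Set ℕ)).subtype with hWdef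
  have hWP : W ≤ degSpan ({k} : Set ℕ) := Submodule.map_subtype_le (degSpan (σ := σ) ({k} : Set ℕ)) _
  have hWst : ∀ U : Matrix.unitaryGroup σ ℂ, ∀ x ∈ W, fockRep U x ∈ W := by
    rintro U _ ⟨y, hy, rfl⟩
    refine ⟨⟨fockRep U (y : FockL2 σ), homogeneousSpan_invariant k U y.2⟩, ?_, rfl⟩
    rw [SetLike.mem_coe, Module.End.mem_eigenspace_iff] at hy ⊢
    have hy' : T (y : FockL2 σ) = c • (y : FockL2 σ) := by
      have h := congrArg Subtype.val hy
      simpa only [LinearMap.coe_restrict_apply, Submodule.coe_smul] using h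
    apply Subtype.ext
    rw [LinearMap.coe_restrict_apply, Submodule.coe_smul]
    show T (fockRep U (y : FockL2 σ)) = c • fockRep U (y : FockL2 σ)
    rw [hT, hy', map_smul]
  have hW0 : W ≠ ⊥ := by
    intro h
    have hvW : ((v : degSpan (σ := σ) ({k} : Set ℕ)) : FockL2 σ) ∈ W := ⟨v, hv.1, rfl⟩
    rw [h, Submodule.mem_bot, Submodule.coe_eq_zero] at hvW
    exact hv.2 hvW
  rcases degSpan_singleton_irreducible k W hWP hWst with h | h
  · exact absurd h hW0
  · intro x hx
    rw [← h] at hx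
    obtain ⟨y, hy, rfl⟩ := hx
    rw [SetLike.mem_coe, Module.End.mem_eigenspace_iff] at hy
    have h := congrArg Subtype.val hy
    simpa only [LinearMap.coe_restrict_apply, Submodule.coe_smul, Submodule.coe_subtype] using h

/-! ## 3. The commutant theorem -/

omit [DecidableEq σ] in
/-- `T ζ_β = c_{|β|} ζ_β` for a degree multiplier. -/
theorem degreeMultiplier_fockBasis {T : FockL2 σ →L[ℂ] FockL2 σ} {c : ℕ → ℂ}
    (hc : ∀ k : ℕ, ∀ x ∈ degSpan ({k} : Set ℕ), T x = c k • x) (β : σ →₀ ℕ) :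
    T (fockBasis β) = c (mdeg β) • (fockBasis β : FockL2 σ) :=
  hc _ _ (fockBasis_mem_degSpan_singleton β)

omit [DecidableEq σ] in
/-- The norm-convergent expansion of a degree multiplier: `T v = Σ_β c_{|β|} ⟨ζ_β, v⟩ ζ_β`. -/
theorem degreeMultiplier_hasSum {T : FockL2 σ →L[ℂ] FockL2 σ} {c : ℕ → ℂ}
    (hc : ∀ k : ℕ, ∀ x ∈ degSpan ({k} : Set ℕ), T x = c k • x) (v : FockL2 σ) :
    HasSum (fun β : σ →₀ ℕ => (c (mdeg β) * ⟪(fockBasis β : FockL2 σ), v⟫_ℂ) • (fockBasis β : FockL2 σ)) (T v) := by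
  have h := T.hasSum ((fockBasis (σ := σ)).hasSum_repr v)
  have hfun : (fun β : σ →₀ ℕ => (c (mdeg β) * ⟪(fockBasis β : FockL2 σ), v⟫_ℂ) • (fockBasis β : FockL2 σ)) =
      fun β : σ →₀ ℕ => T ((fockBasis (σ := σ)).repr v β • (fockBasis β : FockL2 σ)) := by
    funext β
    rw [HilbertBasis.repr_apply_apply, map_smul, degreeMultiplier_fockBasis hc, smul_smul, mul_comm]
  rw [hfun]
  exact h

/-- A degree multiplier commutes with `ν₀(U(σ))`. -/
theorem comm_of_degreeMultiplier (T : FockL2 σ →L[ℂ] FockL2 σ) (c : ℕ → ℂ)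
    (hc : ∀ k : ℕ, ∀ x ∈ degSpan ({k} : Set ℕ), T x = c k • x) (U : Matrix.unitaryGroup σ ℂ) (x : FockL2 σ) :
    T (fockRep U x) = fockRep U (T x) := by
  have key : T.comp (fockRep U).toContinuousLinearEquiv.toContinuousLinearMap =
      (fockRep U).toContinuousLinearEquiv.toContinuousLinearMap.comp T := by
    refine clm_eq_of_fockBasis fun β => ?_
    simp only [ContinuousLinearMap.comp_apply, ContinuousLinearEquiv.coe_coe,
      LinearIsometryEquiv.coe_toContinuousLinearEquiv]
    rw [hc (mdeg β) _ (homogeneousSpan_invariant (mdeg β) U (fockBasis_mem_degSpan_singleton β)),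
      degreeMultiplier_fockBasis hc, map_smul]
  have := DFunLike.congr_fun key x
  simpa only [ContinuousLinearMap.comp_apply, ContinuousLinearEquiv.coe_coe,
    LinearIsometryEquiv.coe_toContinuousLinearEquiv] using this

/-- **The commutant of `ν₀(U(σ))` in `B(𝓕_σ)` is the algebra of bounded degree multipliers** (bounded functions of
the number operator): `(U(σ), U(1))`-duality on the genuine Fock space at the level of bounded operators. -/
theorem unitaryCommutant_iff (T : FockL2 σ →L[ℂ] FockL2 σ) :
    (∀ U : Matrix.unitaryGroup σ ℂ, ∀ x : FockL2 σ, T (fockRep U x) = fockRep U (T x)) ↔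
      ∃ c : ℕ → ℂ, ∀ k : ℕ, ∀ x ∈ degSpan ({k} : Set ℕ), T x = c k • x := by
  constructor
  · intro hT
    choose c hc using fun k =>
      exists_scalar_on_degSpan_singleton (T : FockL2 σ →ₗ[ℂ] FockL2 σ) (fun U x => hT U x) k
    exact ⟨c, fun k x hx => hc k x hx⟩
  · rintro ⟨c, hc⟩
    exact comm_of_degreeMultiplier T c hc

omit [DecidableEq σ] in
/-- The scalars of a degree multiplier are bounded by its operator norm. -/
theorem norm_degreeMultiplier_le {T : FockL2 σ →L[ℂ] FockL2 σ} {c : ℕ → ℂ}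
    (hc : ∀ k : ℕ, ∀ x ∈ degSpan ({k} : Set ℕ), T x = c k • x) (β : σ →₀ ℕ) : ‖c (mdeg β)‖ ≤ ‖T‖ := by
  have h1 : ‖T (fockBasis β)‖ ≤ ‖T‖ * ‖(fockBasis β : FockL2 σ)‖ := T.le_opNorm _
  rw [degreeMultiplier_fockBasis hc, norm_smul, (fockBasis (σ := σ)).orthonormal.1 β, mul_one, mul_one] at h1
  exact h1

/-- **The commutant is commutative**: any two bounded `U(σ)`-intertwiners of `𝓕_σ` commute — the decomposition
`𝓕_σ = ⊕̂ₖ 𝓟ₖ` is multiplicity-free. -/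
theorem unitaryCommutant_comm (T₁ T₂ : FockL2 σ →L[ℂ] FockL2 σ)
    (h₁ : ∀ U : Matrix.unitaryGroup σ ℂ, ∀ x : FockL2 σ, T₁ (fockRep U x) = fockRep U (T₁ x))
    (h₂ : ∀ U : Matrix.unitaryGroup σ ℂ, ∀ x : FockL2 σ, T₂ (fockRep U x) = fockRep U (T₂ x)) :
    T₁.comp T₂ = T₂.comp T₁ := by
  obtain ⟨c₁, hc₁⟩ := (unitaryCommutant_iff T₁).mp h₁
  obtain ⟨c₂, hc₂⟩ := (unitaryCommutant_iff T₂).mp h₂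
  refine clm_eq_of_fockBasis fun β => ?_
  simp only [ContinuousLinearMap.comp_apply]
  rw [degreeMultiplier_fockBasis hc₂, degreeMultiplier_fockBasis hc₁, map_smul, map_smul,
    degreeMultiplier_fockBasis hc₁, degreeMultiplier_fockBasis hc₂, smul_smul, smul_smul, mul_comm]

/-- **`ν₀(U(σ))' ⊆ ν₀(U(1))''`**: a bounded `U(σ)`-intertwiner commutes with every bounded operator that commutes
with the centre (double-commutant form of the `(U(σ), U(1))` duality at bounded-operator level). -/
theorem unitaryCommutant_comm_of_centreCommutant (T S : FockL2 σ →L[ℂ] FockL2 σ)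
    (hT : ∀ U : Matrix.unitaryGroup σ ℂ, ∀ x : FockL2 σ, T (fockRep U x) = fockRep U (T x))
    (hS : ∀ c : Circle, ∀ x : FockL2 σ, S (circleRep c x) = circleRep c (S x)) :
    T.comp S = S.comp T := by
  obtain ⟨c, hc⟩ := (unitaryCommutant_iff T).mp hT
  have hS' := (centreCommutant_iff S).mp hS
  refine clm_eq_of_fockBasis fun β => ?_
  simp only [ContinuousLinearMap.comp_apply]
  rw [hc (mdeg β) _ (hS' _ _ (fockBasis_mem_degSpan_singleton β)), degreeMultiplier_fockBasis hc, map_smul]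

/-- An intertwiner maps every CLOSED invariant subspace `closure ⊕_{k∈D} 𝓟ₖ` into itself. -/
theorem unitaryCommutant_map_mem_closure_degSpan (T : FockL2 σ →L[ℂ] FockL2 σ)
    (hT : ∀ U : Matrix.unitaryGroup σ ℂ, ∀ x : FockL2 σ, T (fockRep U x) = fockRep U (T x)) (D : Set ℕ)
    {x : FockL2 σ} (hx : x ∈ (degSpan D).topologicalClosure) : T x ∈ (degSpan D).topologicalClosure := by
  obtain ⟨c, hc⟩ := (unitaryCommutant_iff T).mp hT
  have hle : degSpan (σ := σ) D ≤ ((degSpan (σ := σ) D).topologicalClosure).comap (T : FockL2 σ →ₗ[ℂ] FockL2 σ) := by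
    rw [degSpan, Submodule.span_le]
    rintro _ ⟨β, hβ, rfl⟩
    rw [SetLike.mem_coe, Submodule.mem_comap]
    show T (fockBasis β) ∈ (degSpan D).topologicalClosure
    rw [degreeMultiplier_fockBasis hc]
    exact Submodule.smul_mem _ _ (Submodule.le_topologicalClosure _ (Submodule.subset_span ⟨β, hβ, rfl⟩))
  have hclosed : IsClosed ((((degSpan (σ := σ) D).topologicalClosure).comap (T : FockL2 σ →ₗ[ℂ] FockL2 σ) :
      Submodule ℂ (FockL2 σ)) : Set (FockL2 σ)) :=
    (Submodule.isClosed_topologicalClosure _).preimage T.continuous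
  exact Submodule.topologicalClosure_minimal _ hle hclosed hx

/-! ## 4. The Schrödinger model `L²(ℝ^σ)` -/

/-- **The commutant in the Schrödinger model.**  A bounded operator on `L²(ℝ^σ)` commutes with all the transported
operators `schrodingerU U = B⁻¹ν₀(U)B` (`U ∈ U(σ)`) iff it is a scalar `c k` on each Hermite piece
`hermDegSpan k = span {h_α : |α| = k}` — transport of `unitaryCommutant_iff` through the Bargmann unitary `B`. -/
theorem schrodingerCommutant_iff
    (T : Lp ℂ 2 (volume : Measure (σ → ℝ)) →L[ℂ] Lp ℂ 2 (volume : Measure (σ → ℝ))) :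
    (∀ U : Matrix.unitaryGroup σ ℂ, ∀ f : Lp ℂ 2 (volume : Measure (σ → ℝ)),
        T (schrodingerU U f) = schrodingerU U (T f)) ↔
      ∃ c : ℕ → ℂ, ∀ k : ℕ, ∀ f ∈ hermDegSpan (σ := σ) k, T f = c k • f := by
  let T' : FockL2 σ →L[ℂ] FockL2 σ :=
    ((bargmann (σ := σ)).toContinuousLinearEquiv.toContinuousLinearMap.comp T).comp
      (bargmann (σ := σ)).symm.toContinuousLinearEquiv.toContinuousLinearMap
  have hT' : ∀ x : FockL2 σ, T' x = bargmann (T (bargmann.symm x)) := fun x => rfl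
  have h1 : (∀ U : Matrix.unitaryGroup σ ℂ, ∀ f : Lp ℂ 2 (volume : Measure (σ → ℝ)),
      T (schrodingerU U f) = schrodingerU U (T f)) ↔
      ∀ U : Matrix.unitaryGroup σ ℂ, ∀ x : FockL2 σ, T' (fockRep U x) = fockRep U (T' x) := by
    constructor
    · intro h U x
      rw [hT', hT']
      have h' := h U (bargmann.symm x)
      rw [schrodingerU_apply, schrodingerU_apply, LinearIsometryEquiv.apply_symm_apply] at h'
      rw [h', LinearIsometryEquiv.apply_symm_apply]
    · intro h U f
      have h' := h U (bargmann f)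
      rw [hT', hT', LinearIsometryEquiv.symm_apply_apply] at h'
      rw [schrodingerU_apply, schrodingerU_apply, ← h', LinearIsometryEquiv.symm_apply_apply]
  have h2 : (∃ c : ℕ → ℂ, ∀ k : ℕ, ∀ f ∈ hermDegSpan (σ := σ) k, T f = c k • f) ↔
      ∃ c : ℕ → ℂ, ∀ k : ℕ, ∀ x ∈ degSpan ({k} : Set ℕ), T' x = c k • x := by
    refine exists_congr fun c => forall_congr' fun k => ⟨fun h x hx => ?_, fun h f hf => ?_⟩
    · have hx' : bargmann.symm x ∈ hermDegSpan (σ := σ) k := by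
        rw [← bargmann_mem_degSpan_iff, LinearIsometryEquiv.apply_symm_apply]
        exact hx
      rw [hT', h _ hx', map_smul, LinearIsometryEquiv.apply_symm_apply]
    · have h' := h (bargmann f) ((bargmann_mem_degSpan_iff k f).mpr hf)
      rw [hT', LinearIsometryEquiv.symm_apply_apply] at h'
      apply (bargmann (σ := σ)).injective
      rw [map_smul]
      exact h'
  rw [h1, h2]
  exact unitaryCommutant_iff T'

/-! ## 5. The representations on `𝓟ₖ` and `𝓟ₗ` (`k ≠ l`) are inequivalent -/

/-- A central element acting by different scalars on `𝓟ₖ` and `𝓟ₗ` when `k ≠ l`. -/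
theorem exists_conj_pow_ne {k l : ℕ} (hkl : k ≠ l) :
    ∃ c : Circle, (conj (c : ℂ)) ^ k ≠ (conj (c : ℂ)) ^ l := by
  refine ⟨(rootU (k + l + 1))⁻¹, fun h => hkl ?_⟩
  rw [conj_coe_rootU_inv] at h
  have hprim : IsPrimitiveRoot (cexp (2 * π * I / (k + l + 1 : ℕ))) (k + l + 1) :=
    Complex.isPrimitiveRoot_exp _ (by omega)
  exact hprim.pow_inj (by omega) (by omega) h

/-- **[Fo89 p. 182, line 39] "The representations of U(n) on the spaces  $\mathcal{P}_k$  are all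
inequivalent"**, in the strong form: for `k ≠ l`, every linear map `𝓟ₖ → 𝓟ₗ` intertwining the two restricted
actions of `U(σ)` is ZERO (the centre already forces it — Folland's parenthetical `n = 1` argument, valid for all n). -/
theorem degSpan_intertwiner_eq_zero {k l : ℕ} (hkl : k ≠ l)
    (S : degSpan (σ := σ) ({k} : Set ℕ) →ₗ[ℂ] degSpan (σ := σ) ({l} : Set ℕ))
    (hS : ∀ U : Matrix.unitaryGroup σ ℂ, ∀ x : degSpan (σ := σ) ({k} : Set ℕ),
      (S ⟨fockRep U (x : FockL2 σ), homogeneousSpan_invariant k U x.2⟩ : FockL2 σ) = fockRep U (S x : FockL2 σ)) :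
    S = 0 := by
  obtain ⟨c, hc⟩ := exists_conj_pow_ne hkl
  refine LinearMap.ext fun x => Subtype.ext ?_
  have h1 := hS (scalarU c) x
  have hx : fockRep (scalarU c) (x : FockL2 σ) = ((conj (c : ℂ)) ^ k) • (x : FockL2 σ) :=
    circleRep_of_mem_degSpan_singleton x.2 c
  have hSx : fockRep (scalarU c) (S x : FockL2 σ) = ((conj (c : ℂ)) ^ l) • (S x : FockL2 σ) :=
    circleRep_of_mem_degSpan_singleton (S x).2 c
  have h2 : (⟨fockRep (scalarU c) (x : FockL2 σ), homogeneousSpan_invariant k (scalarU c) x.2⟩ :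
      degSpan (σ := σ) ({k} : Set ℕ)) = ((conj (c : ℂ)) ^ k) • x := Subtype.ext hx
  rw [h2, map_smul, Submodule.coe_smul, hSx] at h1
  have h3 : ((conj (c : ℂ)) ^ k - (conj (c : ℂ)) ^ l) • (S x : FockL2 σ) = 0 := by
    rw [sub_smul, h1, sub_self]
  rw [smul_eq_zero, sub_eq_zero] at h3
  rcases h3 with h3 | h3
  · exact absurd h3 hc
  · rw [h3, LinearMap.zero_apply, Submodule.coe_zero]

end HodgeCM.PerL34.Fock.Hermite

end
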